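import Summits.NavierStokesRegularity.NavierStokesRegularity.Theorems.PoloidalWindowDoorPoloidalWindowRigidityZShockRotatingProfileFlux
import Summits.NavierStokesRegularity.NavierStokesRegularity.Theorems.PoloidalWindowDoorPoloidalWindowRigidityZShockZeroMeanDatum
import HarnessLib

/-!
# Crux K2 `PoloidalWindowRigidity` (stmt-NavierStokesRegularity-19708), line `z_shock` — R3 inhabitant census: ROTATING PATTERNS (XI) —
# bad-sign data on every circle: the angular derivative `ΘΨ` of a `C²` function takes, on each circle, a value `≤ −E/(4πM)`
# (`E` = angular `L²`-mass on the circle, `M` = bound), and for a ROTATING PROFILE `M = 2πC/ω²` is universal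

`--supports stmt-NavierStokesRegularity-19708 --as helper` (leafhand-ns-poloidalwindowdoor-3 g9, cell decomp-ns, 2026-08-31).  Class-free,
def-free; parts I (`…RotatingProfile`), IV (`…RotatingProfileFlux`), X (`…ZeroMeanDatum`).  **No stub and no summit is closed by this file;
Navier–Stokes regularity is NOT proved here (rung 0).**

WHY THIS FILE.  Census item F4 (evidence #47/#48): forward blow-up along the radius (`…ZShockRiccatiForced.riccati_forced_forward_noGlobal`)
needs on the circle of radius `r₀` a datum of the angular-derivative variable of the bad sign and of quantified size.  The supply mechanism is
periodicity: `∮ ΘΨ dα = 0` on every circle (part IV `integral_angularDeriv_eq_zero`), `|ΘΨ| ≤ 2πC/ω²` for a rotating profile (part I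
`angularDeriv_abs_le_of_rotating`), and the angular `L²`-mass `E(r) = ∮ ΘΨ² dα` is what the energy circle law (part VI) controls.  Composing
with the zero-mean datum lemma (part X):

* ★ `circle_angularDeriv_le_neg` — `Ψ ∈ C²`, on the circle of radius `r`: `|ΘΨ| ≤ M`, `E ≤ ∮ ΘΨ² dα`, `0 < E`, `0 < M` ⟹ there is an angle
  with `ΘΨ(P r α) ≤ −E/(4πM)`; `circle_angularDeriv_ge` — the sign twin;
* ★ `circle_angularDeriv_le_neg_of_rotating` — for a solution of the rotating profile equation `ω² ΘΘΨ = Σᵢ∂ᵢ(γ(Ψ)∂ᵢΨ)` with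
  `|Σᵢ∂ᵢ(γ(Ψ)∂ᵢΨ)| ≤ C` the bound is universal, `M = 2πC/ω²`: an angle with `ΘΨ ≤ −E ω²/(8π² C)` on EVERY circle carrying mass `E`.

What remains for F4 (not here): that this datum beats the remaining `O(1/r)` source budget of the forced Riccati law along the outgoing
characteristic through that point — the quantitative heart. [folklore]
-/

noncomputable section

namespace Summit.NavierStokesRegularity.NavierStokesRegularity.Theorems.PoloidalWindowDoorPoloidalWindowRigidityZShockRotatingProfileCircleDatum

-- the summit and its single sub-problem share the name (CONVENTIONS §1)
set_option linter.dupNamespace false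

open Set Filter Topology MeasureTheory intervalIntegral
open Summit.NavierStokesRegularity.NavierStokesRegularity.Theorems.PoloidalWindowDoorPoloidalWindowRigidityZShockRotatingProfile Summit.NavierStokesRegularity.NavierStokesRegularity.Theorems.PoloidalWindowDoorPoloidalWindowRigidityZShockRotatingProfileFlux Summit.NavierStokesRegularity.NavierStokesRegularity.Theorems.PoloidalWindowDoorPoloidalWindowRigidityZShockZeroMeanDatum

variable {Ψ : EuclideanSpace ℝ (Fin 2) → ℝ} {γ : ℝ → ℝ} {J : EuclideanSpace ℝ (Fin 2) → EuclideanSpace ℝ (Fin 2)}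
  {P : ℝ → ℝ → EuclideanSpace ℝ (Fin 2)} {ω : ℝ}

/-- The angular derivative along a circle, `α ↦ DΨ(P r α)[J(P r α)]`, is continuous for `Ψ ∈ C²`. [folklore] -/
theorem continuous_angularDeriv_circle (hΨ : ContDiff ℝ 2 Ψ)
    (hP : ∀ r α, P r α = (r * Real.cos α) • EuclideanSpace.single (0 : Fin 2) (1 : ℝ) + (r * Real.sin α) • EuclideanSpace.single (1 : Fin 2) (1 : ℝ))
    (hJ : ∀ y' : EuclideanSpace ℝ (Fin 2), J y' = (-(y' 1)) • EuclideanSpace.single (0 : Fin 2) (1 : ℝ) +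
      (y' 0) • EuclideanSpace.single (1 : Fin 2) (1 : ℝ))
    (r : ℝ) : Continuous fun α => fderiv ℝ Ψ (P r α) (J (P r α)) := by
  have hDc : Continuous (fderiv ℝ Ψ) := hΨ.continuous_fderiv two_ne_zero
  have hJ' : J = fun y' => (-(y' 1)) • EuclideanSpace.single (0 : Fin 2) (1 : ℝ) +
      (y' 0) • EuclideanSpace.single (1 : Fin 2) (1 : ℝ) := funext hJ
  have hJc : Continuous J := by rw [hJ']; fun_prop
  have hPr : Continuous fun α => P r α := (continuous_polar hP).comp (continuous_const.prodMk continuous_id)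
  exact (hDc.comp hPr).clm_apply (hJc.comp hPr)

/-- ★ **Bad-sign angular datum on a circle.**  For `Ψ ∈ C²` and a radius `r`: if `|ΘΨ| ≤ M` on the circle and the angular `L²`-mass
satisfies `E ≤ ∫₀^{2π} ΘΨ(P r α)² dα` (`0 < E`, `0 < M`), some angle has `ΘΨ(P r α) ≤ −E/(4πM)` (zero mean of `ΘΨ` on circles). [folklore] -/
theorem circle_angularDeriv_le_neg (hΨ : ContDiff ℝ 2 Ψ)
    (hP : ∀ r α, P r α = (r * Real.cos α) • EuclideanSpace.single (0 : Fin 2) (1 : ℝ) + (r * Real.sin α) • EuclideanSpace.single (1 : Fin 2) (1 : ℝ))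
    (hJ : ∀ y' : EuclideanSpace ℝ (Fin 2), J y' = (-(y' 1)) • EuclideanSpace.single (0 : Fin 2) (1 : ℝ) +
      (y' 0) • EuclideanSpace.single (1 : Fin 2) (1 : ℝ))
    (r : ℝ) {M E : ℝ} (hM : ∀ α ∈ Icc (0 : ℝ) (2 * Real.pi), |fderiv ℝ Ψ (P r α) (J (P r α))| ≤ M)
    (hMpos : 0 < M) (hEpos : 0 < E)
    (hE : E ≤ ∫ α in (0 : ℝ)..2 * Real.pi, (fderiv ℝ Ψ (P r α) (J (P r α))) ^ 2) :
    ∃ α ∈ Icc (0 : ℝ) (2 * Real.pi), fderiv ℝ Ψ (P r α) (J (P r α)) ≤ -(E / (4 * Real.pi * M)) := by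
  have hmean := integral_angularDeriv_eq_zero (hΨ.of_le one_le_two) hP hJ r
  obtain ⟨α, hα, h⟩ := exists_le_neg_of_integral_eq_zero Real.two_pi_pos (continuous_angularDeriv_circle hΨ hP hJ r)
    hM hMpos hEpos hmean hE
  refine ⟨α, hα, ?_⟩
  have e : E / (2 * M * (2 * Real.pi - 0)) = E / (4 * Real.pi * M) := by rw [sub_zero]; ring
  rw [e] at h
  exact h

/-- **Good-sign twin**: under the same hypotheses some angle has `E/(4πM) ≤ ΘΨ(P r α)`. [folklore] -/
theorem circle_angularDeriv_ge (hΨ : ContDiff ℝ 2 Ψ)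
    (hP : ∀ r α, P r α = (r * Real.cos α) • EuclideanSpace.single (0 : Fin 2) (1 : ℝ) + (r * Real.sin α) • EuclideanSpace.single (1 : Fin 2) (1 : ℝ))
    (hJ : ∀ y' : EuclideanSpace ℝ (Fin 2), J y' = (-(y' 1)) • EuclideanSpace.single (0 : Fin 2) (1 : ℝ) +
      (y' 0) • EuclideanSpace.single (1 : Fin 2) (1 : ℝ))
    (r : ℝ) {M E : ℝ} (hM : ∀ α ∈ Icc (0 : ℝ) (2 * Real.pi), |fderiv ℝ Ψ (P r α) (J (P r α))| ≤ M)
    (hMpos : 0 < M) (hEpos : 0 < E)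
    (hE : E ≤ ∫ α in (0 : ℝ)..2 * Real.pi, (fderiv ℝ Ψ (P r α) (J (P r α))) ^ 2) :
    ∃ α ∈ Icc (0 : ℝ) (2 * Real.pi), E / (4 * Real.pi * M) ≤ fderiv ℝ Ψ (P r α) (J (P r α)) := by
  have hmean := integral_angularDeriv_eq_zero (hΨ.of_le one_le_two) hP hJ r
  obtain ⟨α, hα, h⟩ := exists_ge_of_integral_eq_zero Real.two_pi_pos (continuous_angularDeriv_circle hΨ hP hJ r)
    hM hMpos hEpos hmean hE
  refine ⟨α, hα, ?_⟩
  have e : E / (2 * M * (2 * Real.pi - 0)) = E / (4 * Real.pi * M) := by rw [sub_zero]; ring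
  rw [e] at h
  exact h

/-- ★ **Universal bad-sign datum for rotating profiles.**  If `Ψ ∈ C²` solves the rotating profile equation
`ω² ΘΘΨ = Σᵢ ∂ᵢ(γ(Ψ)∂ᵢΨ)` (`ω ≠ 0`) with `|Σᵢ ∂ᵢ(γ(Ψ)∂ᵢΨ)| ≤ C`, `0 < C`, then on EVERY circle whose angular `L²`-mass is `≥ E > 0`
some angle has `ΘΨ ≤ −E ω² / (8π² C)` (part I: `|ΘΨ| ≤ 2πC/ω²` everywhere). [folklore] -/
theorem circle_angularDeriv_le_neg_of_rotating (hΨ : ContDiff ℝ 2 Ψ) (hω : ω ≠ 0)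
    (hP : ∀ r α, P r α = (r * Real.cos α) • EuclideanSpace.single (0 : Fin 2) (1 : ℝ) + (r * Real.sin α) • EuclideanSpace.single (1 : Fin 2) (1 : ℝ))
    (hJ : ∀ y' : EuclideanSpace ℝ (Fin 2), J y' = (-(y' 1)) • EuclideanSpace.single (0 : Fin 2) (1 : ℝ) +
      (y' 0) • EuclideanSpace.single (1 : Fin 2) (1 : ℝ))
    (hrot : ∀ y : EuclideanSpace ℝ (Fin 2),
      ω ^ 2 * fderiv ℝ (fun y' => fderiv ℝ Ψ y' (J y')) y (J y) =
        ∑ i, fderiv ℝ (fun y' => γ (Ψ y') * fderiv ℝ Ψ y' (EuclideanSpace.single i 1)) y (EuclideanSpace.single i 1))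
    {C : ℝ} (hCpos : 0 < C) (hC : ∀ y : EuclideanSpace ℝ (Fin 2),
      |∑ i, fderiv ℝ (fun y' => γ (Ψ y') * fderiv ℝ Ψ y' (EuclideanSpace.single i 1)) y (EuclideanSpace.single i 1)| ≤ C)
    (r : ℝ) {E : ℝ} (hEpos : 0 < E)
    (hE : E ≤ ∫ α in (0 : ℝ)..2 * Real.pi, (fderiv ℝ Ψ (P r α) (J (P r α))) ^ 2) :
    ∃ α ∈ Icc (0 : ℝ) (2 * Real.pi), fderiv ℝ Ψ (P r α) (J (P r α)) ≤ -(E * ω ^ 2 / (8 * Real.pi ^ 2 * C)) := by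
  have hω2 : 0 < ω ^ 2 := by positivity
  have hMpos : 0 < C / ω ^ 2 * (2 * Real.pi) := by positivity
  have hM : ∀ α ∈ Icc (0 : ℝ) (2 * Real.pi), |fderiv ℝ Ψ (P r α) (J (P r α))| ≤ C / ω ^ 2 * (2 * Real.pi) :=
    fun α _ => angularDeriv_abs_le_of_rotating hΨ hω hJ hrot hC (P r α)
  obtain ⟨α, hα, h⟩ := circle_angularDeriv_le_neg hΨ hP hJ r hM hMpos hEpos hE
  refine ⟨α, hα, ?_⟩
  have e : E / (4 * Real.pi * (C / ω ^ 2 * (2 * Real.pi))) = E * ω ^ 2 / (8 * Real.pi ^ 2 * C) := by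
    field_simp
    ring
  rw [e] at h
  exact h

end Summit.NavierStokesRegularity.NavierStokesRegularity.Theorems.PoloidalWindowDoorPoloidalWindowRigidityZShockRotatingProfileCircleDatum
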